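/-
Copyright: the b2b-balaban cell (near-miss cell 7), T⁴-continuum CRUX team (coordinator ruling e34b3e0c item (2)),
seat t4-ne7b-formalise-leaf-05 (gen 28). Released under the licence of the surrounding project.
-/
import Summits.QuantumFields.BalabanUV.T4Continuum.Spine.NE7b.BoxNearFlatFilling
import Summits.QuantumFields.BalabanUV.T4Continuum.Spine.NE7b.BoxCollarHolonomy
import Summits.QuantumFields.BalabanUV.T4Continuum.Spine.NE7b.HollowForcedFluxWitness

/-!
# The junction of ROUTES-NE7b v7 item 1's trichotomy: print's box filling applied to W-hol's exterior data
# (route NE7b R-H anatomy under (BOX); `BoxNearFlatFilling` (leaf-06) × `BoxCollarHolonomy` (leaf-01) × `HollowForcedFluxWitness` (leaf-05))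

Cell `pub-balaban`, sub-cell `t4`, spine estimate NE7b (node U5c). ROUTES-NE7b v7 Δv7 item 1 decides the cross-check
A-v6-1 by a trichotomy now present in the tree as three files: the near-flat FILLING of a solid box from near-flat shell
data (`BoxNearFlatFilling.boxFill`, p.193's shell gauge — the (TC-box) side), the positive collar statement
(`BoxCollarHolonomy`, leaf-01), and the NEGATIVE witness W-hol (`HollowForcedFluxWitness.whol`: a torus-shaped hole whose
flat exterior carries a Type-II Wilson loop, so that EVERY filling carries flux). THIS FILE states the three-line junction
between the first and the last ON THE SAME EXPLICIT DATA:

* `shellPlaqSmall_whol` — W-hol's exterior data satisfy print's shell hypothesis `ShellPlaqSmall` with `ε = 0` for the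
  bounding box `[−1−r, m+r]⁴` of the hollow hole `hole m r` (every frozen-coordinate plaquette has a corner off the hole,
  so (W1) `plaquette_whol_eq_one_of_not_mem` makes it `1`);
* `dist1_plaquette_boxFill_whol_le_zero` — hence p.193's filling `boxFill (whol g m)` of that SOLID box is EXACTLY FLAT on
  every plaquette of the big box (`dist1_plaquette_boxFill_le` at `ε = 0`);
* `boxFill_whol_not_agree` — hence, for `0 < dist1 g` and `2r + 3 ≤ m`, `boxFill (whol g m)` is NOT a filling of the
  HOLLOW hole: it rewrites some bond with both endpoints off `hole m r` (a bond of the inner solid region), because a filling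
  agreeing off the hole has `dist1 g ≤ Σ_square dist1` by (W3) `dist1_le_sum_of_agree`, and that sum is `≤ 0`.

So the two files use the SAME exterior-bond convention («touching the box» = an endpoint in it ⇔ not both endpoints
outside = W-hol's agreement clause), and print's construction is near-flat BECAUSE the box is solid; on a torus-shaped
hole's flat exterior data it succeeds only by overwriting the hole's inner exterior. And the junction with the second file:

* `no_flat_boxCollar_contains_whol_loop` — NO FLAT BOX COLLAR CONTAINS A TYPE-II LOOP: if a box annulus
  `ann lo hi lo' hi' ⊂ ℤ⁴` (`B15TreeGauge196.ann`, `P₂ ≠ ∅` strictly inside `P₁`) contained the four sides of W-hol's loop `γ_r`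
  and all its collar plaquettes were flat for `whol q m` (`BoxCollarHolonomy`'s hypothesis at `ε = 0`), then
  `BoxCollarHolonomy.sphere_norm_rectangle_sub_one_le` would give `‖U(γ_r) − 1‖ ≤ 0` against (W2) `U(γ_r) = q ≠ 1` (S³ carrier).

HONEST FRAMING. Law-free lattice gauge algebra on ONE explicit configuration; nothing of [Bałaban 1983–89] asserted or
cited beyond what `B15ShellGauge193` proves with its tags; SUPPLIER-GRADE anatomy (PRICING-NE7b v10: C-RH° KILL-CANDIDATE,
R-P1 KEEP) — moves NO grade. NE7b (`T4WeightBudget.RelWeightBound`) NOT PRINTED, NOT PROVED; spine PROVED 0∕9; rung (B)+1 on a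
FINITE torus T⁴ — NOT infinite volume, NOT the mass gap, NOT Clay. HONEST DEPENDENCY: continuum YM on T⁴ ⇐ BetaPertH ∧ nine
spine estimates (0/9 proved); BetaPertH ⇐ (D1) ∧ (D4) ∧ CAP+tail; G-an2-4 gates asym, D1 and NE2/3/4. POLICY: crux-route work
under `Spine/NE7b/` (FREEZE (0) respected: not a `T4Continuum/Support` leaf); two concrete definitions (`blo`, `bhi`, the
bounding box corners), no `Prop`-valued definition, no `[cite:]`.
-/

set_option autoImplicit false

namespace Summit.QuantumFields.BalabanUV.T4Continuum.NE7b.HollowVersusBoxFilling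

noncomputable section

open scoped Quaternion
open Literature.MathematicalPhysics.QuantumFieldTheory.Balaban1983to89 (GaugeGroup dist1)
open Literature.MathematicalPhysics.QuantumFieldTheory.Balaban1983to89.B7Prop1Explicit (e e_apply)
open Literature.MathematicalPhysics.QuantumFieldTheory.Balaban1983to89.B15ShellGauge193 (Frozen ShellPlaqSmall)
open Literature.MathematicalPhysics.QuantumFieldTheory.Balaban1983to89.B15TreeGauge196 (ann)
open Literature.MathematicalPhysics.QuantumFieldTheory (ZdEdge ZdGaugeConfig)
open Summit.QuantumFields.BalabanUV.T4Continuum.NE7b.NonAbelianStokesReading (curry sphereGaugeGroup)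
open Summit.QuantumFields.BalabanUV.T4Continuum.NE7b.BoxNearFlatFilling
open Summit.QuantumFields.BalabanUV.T4Continuum.NE7b.BoxCollarHolonomy (sphere_norm_rectangle_sub_one_le)
open Summit.QuantumFields.BalabanUV.T4Continuum.NE7b.HollowForcedFluxWitness

variable {G : Type*} [GaugeGroup G]

/-- The lower corner `(−1−r, −1−r, −1−r, −1−r)` of the bounding box of `hole m r`. -/
def blo (r : ℕ) : Fin 4 → ℤ := fun _ => -1 - (r : ℤ)

/-- The upper corner `(m+r, m+r, m+r, m+r)` of the bounding box of `hole m r`. -/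
def bhi (m r : ℕ) : Fin 4 → ℤ := fun _ => (m : ℤ) + r

/-- **W-hol's exterior data satisfy print's shell hypothesis with `ε = 0`** on the bounding box `[blo r, bhi m r]`: every
plaquette based at a point with a coordinate frozen at `−2−r` or `m+r+1` has that corner off `hole m r`, hence is `1`. -/
theorem shellPlaqSmall_whol (g : G) (m r : ℕ) : ShellPlaqSmall (curry (whol g m)) (blo r) (bhi m r) 0 :=
  shellPlaqSmall_of_plaquette (whol g m) (blo r) (bhi m r) fun z κ ν κ₀ _ _ _ hz => by
    have hz' : z ∉ hole m r := by
      rw [mem_hole_iff]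
      simp only [Frozen, blo, bhi] at hz
      fin_cases κ₀ <;> simp at hz ⊢ <;> omega
    rw [plaquette_whol_eq_one_of_not_mem g m r z κ ν (Or.inl hz'), GaugeGroup.dist1_one]

/-- **p.193's filling of the SOLID bounding box is exactly flat on W-hol's data**: every plaquette with its four corners in
the big box `[blo r − 1, bhi m r + 1]` has `dist1 = 0` after filling (`dist1_plaquette_boxFill_le` at `ε = 0`). -/
theorem dist1_plaquette_boxFill_whol_le_zero (g : G) (m r : ℕ) {x : Fin 4 → ℤ} {i j : Fin 4} (hx : blo r - 1 ≤ x)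
    (hxij : x + e i + e j ≤ bhi m r + 1) :
    dist1 (ZdGaugeConfig.plaquette (boxFill (whol g m) (blo r) (bhi m r)) x i j) ≤ 0 := by
  have h := dist1_plaquette_boxFill_le (whol g m) (shellPlaqSmall_whol g m r) le_rfl (by norm_num : 3 ≤ 4)
    (show blo r ≤ bhi m r from fun κ => by simp only [blo, bhi]; omega) (n := m + 2 * r + 1)
    (fun κ => by simp only [blo, bhi]; push_cast; omega) hx hxij
  simpa using h

/-- **The solid-box filling is NOT a filling of the HOLLOW hole** (`0 < dist1 g`, `2r + 3 ≤ m`): it does not agree with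
`whol g m` on every bond with both endpoints off `hole m r` — it rewrites the inner solid region. Otherwise (W3)
`dist1_le_sum_of_agree` would give `dist1 g ≤ Σ_square dist1 ≤ 0`. -/
theorem boxFill_whol_not_agree (g : G) {m r : ℕ} (hm : 2 * r + 3 ≤ m) (hg : 0 < dist1 g) :
    ¬ ∀ (y : Fin 4 → ℤ) (μ : Fin 4), y ∉ hole m r → y + Pi.single μ 1 ∉ hole m r →
      boxFill (whol g m) (blo r) (bhi m r) (y, μ) = whol g m (y, μ) := by
  intro hagree
  have h := dist1_le_sum_of_agree g hm hagree
  have h0 : ∑ s ∈ Finset.range m, ∑ t ∈ Finset.range (2 * r + 3),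
      dist1 (ZdGaugeConfig.plaquette (boxFill (whol g m) (blo r) (bhi m r))
        (base r + Pi.single 0 (s : ℤ) + Pi.single 2 (t : ℤ)) 0 2) ≤ 0 := by
    refine Finset.sum_nonpos fun s hs => Finset.sum_nonpos fun t ht => ?_
    have hs' := Finset.mem_range.mp hs
    have ht' := Finset.mem_range.mp ht
    refine dist1_plaquette_boxFill_whol_le_zero g m r (fun κ => ?_) (fun κ => ?_)
    · fin_cases κ <;> simp [blo, base] <;> omega
    · fin_cases κ <;> simp [bhi, base, e_apply] <;> omega
  linarith

/-- … whereas on the SOLID box it keeps every bond not touching the box (`BoxNearFlatFilling.boxFill_apply_of_not_touches`):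
the rewritten bonds all touch the bounding box, i.e. lie in the hollow hole's inner region or on the hole itself. -/
theorem boxFill_whol_apply_of_not_touches (g : G) (m r : ℕ) {y : Fin 4 → ℤ} {μ : Fin 4}
    (h : (y, μ) ∉ touchingBonds (blo r) (bhi m r)) : boxFill (whol g m) (blo r) (bhi m r) (y, μ) = whol g m (y, μ) :=
  boxFill_apply_of_not_touches _ _ _ h

/-- **The `S³` reading** (unit quaternions, `q ≠ 1`): p.193's solid-box filling of W-hol's data does not agree with them on
the exterior of the hollow hole. -/
theorem sphere_boxFill_whol_not_agree (q : Metric.sphere (0 : ℍ) 1) (hq : (q : ℍ) ≠ 1) {m r : ℕ} (hm : 2 * r + 3 ≤ m) :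
    ¬ ∀ (y : Fin 4 → ℤ) (μ : Fin 4), y ∉ hole m r → y + Pi.single μ 1 ∉ hole m r →
      boxFill (whol q m) (blo r) (bhi m r) (y, μ) = whol q m (y, μ) := by
  letI : GaugeGroup (Metric.sphere (0 : ℍ) 1) := sphereGaugeGroup
  exact boxFill_whol_not_agree q hm (norm_pos_iff.mpr (sub_ne_zero.mpr hq))

/-- **NO FLAT BOX COLLAR CONTAINS A TYPE-II LOOP** (`S³` carrier, `q ≠ 1`, `2r + 3 ≤ m`): W-hol's loop `γ_r` — the
`m × (2r+3)` rectangle at `base r` in the `(0,2)`-plane, holonomy `q` by (W2) — is contained in no box annulus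
`ann lo hi lo' hi' ⊂ ℤ⁴` (`P₂ ≠ ∅` strictly inside `P₁`, sides `≤ W + 1` sites) all of whose collar plaquettes are flat for
`whol q m`: `BoxCollarHolonomy.sphere_norm_rectangle_sub_one_le` ((TC-box) in holonomy form) would force `‖q − 1‖ ≤ 0`. The box
collar and the torus-shaped hole are the two sides of ROUTES-NE7b v7 item 1, consistent on explicit data. -/
theorem no_flat_boxCollar_contains_whol_loop (q : Metric.sphere (0 : ℍ) 1) (hq : (q : ℍ) ≠ 1) {m r : ℕ}
    (hm : 2 * r + 3 ≤ m) {lo hi lo' hi' : Fin 4 → ℤ} (hlo : ∀ κ, lo κ < lo' κ) (hhi : ∀ κ, hi' κ < hi κ)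
    (hP₂ : lo' ≤ hi') {W : ℕ} (hW : ∀ κ, hi κ - lo κ ≤ W)
    (hflat : ∀ (z : Fin 4 → ℤ) (κ μ : Fin 4), κ ≠ μ → z ∈ ann lo hi lo' hi' → z + e κ ∈ ann lo hi lo' hi' →
      z + e μ ∈ ann lo hi lo' hi' → z + e κ + e μ ∈ ann lo hi lo' hi' →
      ‖((ZdGaugeConfig.plaquette (whol q m) z κ μ : Metric.sphere (0 : ℍ) 1) : ℍ) - 1‖ ≤ 0)
    (h₁ : ∀ s : ℕ, s ≤ m → base r + Pi.single 0 (s : ℤ) ∈ ann lo hi lo' hi')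
    (h₂ : ∀ t : ℕ, t ≤ 2 * r + 3 → base r + Pi.single 0 (m : ℤ) + Pi.single 2 (t : ℤ) ∈ ann lo hi lo' hi')
    (h₃ : ∀ s : ℕ, s ≤ m → base r + Pi.single 0 (s : ℤ) + Pi.single 2 ((2 * r + 3 : ℕ) : ℤ) ∈ ann lo hi lo' hi')
    (h₄ : ∀ t : ℕ, t ≤ 2 * r + 3 → base r + Pi.single 2 (t : ℤ) ∈ ann lo hi lo' hi') : False := by
  have h := sphere_norm_rectangle_sub_one_le hlo hhi hP₂ hW (whol q m) le_rfl hflat h₁ h₂ h₃ h₄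
  rw [rectangle_whol_base q hm] at h
  have h0 : ‖(q : ℍ) - 1‖ ≤ 0 := by simpa using h
  exact hq (sub_eq_zero.mp (norm_le_zero_iff.mp h0))

end

end Summit.QuantumFields.BalabanUV.T4Continuum.NE7b.HollowVersusBoxFilling
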